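import Literature.NumberTheory.DiophantineGeometry.GenEllDeRamificationArchFamily
import Mathlib.NumberTheory.Height.NumberField
import HarnessLib

/-!
# The ramification form `N_c` of the family `t_c` on `D_e`: number-field and height forms of the
# archimedean lower bound ([GenEll] Thm. 2.1 (ii) ⇒ (i), §3 (d) of the number-field-only plan —
# the `c`-parametric twin of the number-field section of `GenEllDeRamificationArch` and of
# `GenEllDeRamificationArchHeight`)

S. Mochizuki, *Arithmetic elliptic curves in general position*, Math. J. Okayama Univ. **52** (2010)
[cite: MochizukiGenEll2010, Thm 2.1 p.12], proof of Thm. 2.1 (ii) ⇒ (i), kurims pp. 12–13.  PROOF-ONLY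
companion of `GenEllDeRamificationArchFamily.lean` (abc-iut cell, GenEllTwo work package W5b for the
FAMILY `t_c = 1/r + c·r^{k+1}/s` of OWNER RULING #6 / its amendment; route item
`Summit.ABC.ABC.Theses.IUTThetaPilot.GenEllTwo`), with `N_c = DeFamily.N k c` (the tree's
`GenEllDeCriticalCollisions.lean`) and `c ∈ ℚ^×` (so that every embedding fixes `c` and the constants
are uniform in the number field):

* `sum_posLog_le`, `exists_sum_posLog_le` — `∀ c ∈ ℚ^× ∀ ρ > 0 ∃ C ≥ 0`, for every number field `K`
  and `(x, r) ∈ D_e(K)` all of whose conjugates `(σ x, σ r)` are `ρ`-separated (sup-distance on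
  `ℂ × ℂ`) from the zeros of `N_c` on `D_e(ℂ)`, `Σ_{σ : K →+* ℂ} log⁺ ‖σ(N_c(x,r))‖⁻¹ ≤ [K:ℚ]·C`;
  `x`-currency form `sum_posLog_le_of_fst_separated` ("all conjugates of `Q.x` `r`-far from `X_φ`");
* `le_infinitePlace_N`, `posLog_infinitePlace_le` — the `InfinitePlace` forms = the hypothesis
  `harch : ∀ v : InfinitePlace L, log⁺ (v N⁻¹) ≤ C₃` of the place-wise summation
  `FibreConductor.inv_finrank_mul_sum_logNorm_le_slope` at `N := N_c(x, r)`;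
* `sum_mult_posLog_infinitePlace_le`, `logHeight₁_sub_le_finsum_posLog`,
  `exists_logHeight₁_le_finsum_posLog_add` — the height form
  `logHeight₁ (N_c(x,r)) − [K:ℚ]·C ≤ Σᶠ_{w finite} log⁺ (w N_c(x,r))⁻¹` via Mathlib's
  `NumberField.logHeight₁_eq` and `logHeight₁ a⁻¹ = logHeight₁ a`.

Everything is proved; no definitions, no named facts.  Classical and undisputed; nothing here refers to
the disputed parts of the abc-iut corpus.
-/

noncomputable section

open Real

namespace Literature.NumberTheory.DiophantineGeometry.GenEll

namespace DeFamily

/-! ### Number-field form: the sum over the complex embeddings -/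

section NumberField

variable {k : ℕ}

/-- Per-conjugate form for an arbitrary parameter `c ∈ K`, stated with a lower-bound constant `δ` for
the zeros of `N_{σ c}`: for a field `K`, `(x, r) ∈ D_e(K)` and a homomorphism `σ : K →+* ℂ` whose
conjugate is `ρ`-separated from the zeros of `N_{σ c}` on `D_e(ℂ)`, `δ ≤ ‖σ(N_c(x, r))‖`.
[cite: MochizukiGenEll2010, Thm 2.1 p.12] -/
theorem le_norm_embedding_N {K : Type*} [Field K] {x r c : K}
    (hxr : r ^ (2 * k + 1) = x * (1 - x)) (σ : K →+* ℂ) {ρ δ : ℝ}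
    (h : ∀ P ∈ DeArch.curve ℂ k, (∀ Q ∈ DeArch.curve ℂ k, N k (σ c) Q = 0 → ρ ≤ dist P Q) →
      δ ≤ ‖N k (σ c) P‖)
    (hsep : ∀ Q ∈ DeArch.curve ℂ k, N k (σ c) Q = 0 → ρ ≤ dist ((σ x, σ r) : ℂ × ℂ) Q) :
    δ ≤ ‖σ (N k c (x, r))‖ := by
  rw [map_N]
  exact h (σ x, σ r) (DeArch.embedding_mem_curve hxr σ) hsep

/-- Per-conjugate form for a RATIONAL parameter `c ∈ ℚ` (the same `N_c` at every conjugate), with the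
constant of `exists_pos_le_norm_N_of_separated (c := (c : ℂ))`. [cite: MochizukiGenEll2010, Thm 2.1 p.12] -/
theorem le_norm_embedding_N_ratCast {K : Type*} [Field K] {x r : K} {c : ℚ}
    (hxr : r ^ (2 * k + 1) = x * (1 - x)) (σ : K →+* ℂ) {ρ δ : ℝ}
    (h : ∀ P ∈ DeArch.curve ℂ k, (∀ Q ∈ DeArch.curve ℂ k, N k (c : ℂ) Q = 0 → ρ ≤ dist P Q) →
      δ ≤ ‖N k (c : ℂ) P‖)
    (hsep : ∀ Q ∈ DeArch.curve ℂ k, N k (c : ℂ) Q = 0 → ρ ≤ dist ((σ x, σ r) : ℂ × ℂ) Q) :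
    δ ≤ ‖σ (N k (c : K) (x, r))‖ := by
  rw [map_N_ratCast]
  exact h (σ x, σ r) (DeArch.embedding_mem_curve hxr σ) hsep

/-- SUM OVER THE COMPLEX EMBEDDINGS (the archimedean term of the height of `N_c(x, r)`, `c ∈ ℚ`), with
the constant `δ` of `exists_pos_le_norm_N_of_separated`: for a number field `K` and `(x, r) ∈ D_e(K)`
all of whose conjugates `(σ x, σ r)` are `ρ`-separated from the zeros of `N_c` on `D_e(ℂ)`,
`Σ_{σ : K →+* ℂ} log⁺ ‖σ(N_c(x,r))‖⁻¹ ≤ [K:ℚ] · log⁺ δ⁻¹`. [cite: MochizukiGenEll2010, Thm 2.1 p.12] -/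
theorem sum_posLog_le {K : Type*} [Field K] [NumberField K] {x r : K} {c : ℚ}
    (hxr : r ^ (2 * k + 1) = x * (1 - x)) {ρ δ : ℝ} (hδ : 0 < δ)
    (h : ∀ P ∈ DeArch.curve ℂ k, (∀ Q ∈ DeArch.curve ℂ k, N k (c : ℂ) Q = 0 → ρ ≤ dist P Q) →
      δ ≤ ‖N k (c : ℂ) P‖)
    (hsep : ∀ σ : K →+* ℂ, ∀ Q ∈ DeArch.curve ℂ k, N k (c : ℂ) Q = 0 →
      ρ ≤ dist ((σ x, σ r) : ℂ × ℂ) Q) :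
    ∑ σ : K →+* ℂ, log⁺ ‖σ (N k (c : K) (x, r))‖⁻¹ ≤ Module.finrank ℚ K * log⁺ δ⁻¹ := by
  have hterm : ∀ σ : K →+* ℂ, log⁺ ‖σ (N k (c : K) (x, r))‖⁻¹ ≤ log⁺ δ⁻¹ := fun σ =>
    DeArch.posLog_inv_norm_le hδ (le_norm_embedding_N_ratCast hxr σ h (hsep σ))
  calc ∑ σ : K →+* ℂ, log⁺ ‖σ (N k (c : K) (x, r))‖⁻¹
      ≤ ∑ _σ : K →+* ℂ, log⁺ δ⁻¹ := Finset.sum_le_sum fun σ _ => hterm σ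
    _ = Module.finrank ℚ K * log⁺ δ⁻¹ := by
      rw [Finset.sum_const, Finset.card_univ, NumberField.Embeddings.card K ℂ, nsmul_eq_mul]

/-- NUMBER-FIELD FORM, packaged: for every `c ∈ ℚ^×` and `ρ > 0` there is `C ≥ 0` (depending only on
`e`, `c`, `ρ`) such that for every number field `K` and every `(x, r) ∈ D_e(K)` all of whose complex
conjugates are `ρ`-separated from the zeros of `N_c` on `D_e(ℂ)`,
`Σ_{σ : K →+* ℂ} log⁺ ‖σ(N_c(x,r))‖⁻¹ ≤ [K:ℚ]·C`. [cite: MochizukiGenEll2010, Thm 2.1 p.12] -/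
theorem exists_sum_posLog_le (k : ℕ) {c : ℚ} (hc : c ≠ 0) {ρ : ℝ} (hρ : 0 < ρ) :
    ∃ C : ℝ, 0 ≤ C ∧ ∀ (K : Type) [Field K] [NumberField K] (x r : K),
      r ^ (2 * k + 1) = x * (1 - x) →
      (∀ σ : K →+* ℂ, ∀ Q ∈ DeArch.curve ℂ k, N k (c : ℂ) Q = 0 →
        ρ ≤ dist ((σ x, σ r) : ℂ × ℂ) Q) →
      ∑ σ : K →+* ℂ, log⁺ ‖σ (N k (c : K) (x, r))‖⁻¹ ≤ Module.finrank ℚ K * C := by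
  obtain ⟨δ, hδ, h⟩ :=
    exists_pos_le_norm_N_of_separated k (c := (c : ℂ)) (by exact_mod_cast hc) hρ
  exact ⟨log⁺ δ⁻¹, posLog_nonneg, fun K _ _ x r hxr hsep => sum_posLog_le hxr hδ h hsep⟩

/-- NUMBER-FIELD FORM in `x`-currency: the same bound when every zero of `N_c` on `D_e(ℂ)` has
`x`-coordinate in `X ⊆ ℂ` and every conjugate `σ x` is `ρ`-far from `X` ("all conjugates of `Q.x`
`r`-far from `X_φ` at `∞`"). [cite: MochizukiGenEll2010, Thm 2.1 p.12] -/
theorem sum_posLog_le_of_fst_separated {K : Type*} [Field K] [NumberField K] {x r : K} {c : ℚ}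
    (hxr : r ^ (2 * k + 1) = x * (1 - x)) {ρ δ : ℝ} (hδ : 0 < δ)
    (h : ∀ P ∈ DeArch.curve ℂ k, (∀ Q ∈ DeArch.curve ℂ k, N k (c : ℂ) Q = 0 → ρ ≤ dist P Q) →
      δ ≤ ‖N k (c : ℂ) P‖)
    {X : Set ℂ} (hX : ∀ Q ∈ DeArch.curve ℂ k, N k (c : ℂ) Q = 0 → Q.1 ∈ X)
    (hsep : ∀ σ : K →+* ℂ, ∀ a ∈ X, ρ ≤ ‖σ x - a‖) :
    ∑ σ : K →+* ℂ, log⁺ ‖σ (N k (c : K) (x, r))‖⁻¹ ≤ Module.finrank ℚ K * log⁺ δ⁻¹ :=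
  sum_posLog_le hxr hδ h fun σ => separated_of_fst_separated hX (P := (σ x, σ r)) (hsep σ)

/-- `InfinitePlace` form of the per-conjugate bound (`c ∈ ℚ`): `δ ≤ w (N_c(x, r))` for every infinite
place `w` whose embedding is `ρ`-separated (`w a = ‖w.embedding a‖`).
[cite: MochizukiGenEll2010, Thm 2.1 p.12] -/
theorem le_infinitePlace_N {K : Type*} [Field K] {x r : K} {c : ℚ}
    (hxr : r ^ (2 * k + 1) = x * (1 - x)) {ρ δ : ℝ}
    (h : ∀ P ∈ DeArch.curve ℂ k, (∀ Q ∈ DeArch.curve ℂ k, N k (c : ℂ) Q = 0 → ρ ≤ dist P Q) →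
      δ ≤ ‖N k (c : ℂ) P‖)
    (w : NumberField.InfinitePlace K)
    (hsep : ∀ Q ∈ DeArch.curve ℂ k, N k (c : ℂ) Q = 0 →
      ρ ≤ dist ((w.embedding x, w.embedding r) : ℂ × ℂ) Q) :
    δ ≤ w (N k (c : K) (x, r)) := by
  rw [← NumberField.InfinitePlace.norm_embedding_eq w (N k (c : K) (x, r))]
  exact le_norm_embedding_N_ratCast hxr w.embedding h hsep

/-- `InfinitePlace` log form (`c ∈ ℚ`): `log⁺ (w (N_c(x,r)))⁻¹ ≤ log⁺ δ⁻¹` under `ρ`-separation of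
`w.embedding` — the hypothesis `harch : ∀ v : InfinitePlace L, log⁺ (v N⁻¹) ≤ C₃` of
`FibreConductor.inv_finrank_mul_sum_logNorm_le_slope` at `N := N_c(x, r)`.
[cite: MochizukiGenEll2010, Thm 2.1 p.12] -/
theorem posLog_infinitePlace_le {K : Type*} [Field K] {x r : K} {c : ℚ}
    (hxr : r ^ (2 * k + 1) = x * (1 - x)) {ρ δ : ℝ} (hδ : 0 < δ)
    (h : ∀ P ∈ DeArch.curve ℂ k, (∀ Q ∈ DeArch.curve ℂ k, N k (c : ℂ) Q = 0 → ρ ≤ dist P Q) →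
      δ ≤ ‖N k (c : ℂ) P‖)
    (w : NumberField.InfinitePlace K)
    (hsep : ∀ Q ∈ DeArch.curve ℂ k, N k (c : ℂ) Q = 0 →
      ρ ≤ dist ((w.embedding x, w.embedding r) : ℂ × ℂ) Q) :
    log⁺ (w (N k (c : K) (x, r)))⁻¹ ≤ log⁺ δ⁻¹ := by
  rw [← NumberField.InfinitePlace.norm_embedding_eq w (N k (c : K) (x, r))]
  exact DeArch.posLog_inv_norm_le hδ (le_norm_embedding_N_ratCast hxr w.embedding h hsep)

end NumberField

/-! ### Height form: the finite part of the height of `N_c(P)` is large under separation -/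

section HeightForm

open Height NumberField

variable {k : ℕ}

/-- ARCHIMEDEAN TERM OF THE HEIGHT, `InfinitePlace` form with multiplicities (`c ∈ ℚ`): under
`ρ`-separation of all complex conjugates, `Σ_{v ∣ ∞} mult(v)·log⁺ (v N_c(x,r))⁻¹ ≤ [K:ℚ]·log⁺ δ⁻¹`
— the archimedean part of `logHeight₁ (N_c(x,r))⁻¹` in Mathlib's `NumberField.logHeight₁_eq`.
[cite: MochizukiGenEll2010, Thm 2.1 p.12] -/
theorem sum_mult_posLog_infinitePlace_le {K : Type*} [Field K] [NumberField K] {x r : K} {c : ℚ}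
    (hxr : r ^ (2 * k + 1) = x * (1 - x)) {ρ δ : ℝ} (hδ : 0 < δ)
    (h : ∀ P ∈ DeArch.curve ℂ k, (∀ Q ∈ DeArch.curve ℂ k, N k (c : ℂ) Q = 0 → ρ ≤ dist P Q) →
      δ ≤ ‖N k (c : ℂ) P‖)
    (hsep : ∀ σ : K →+* ℂ, ∀ Q ∈ DeArch.curve ℂ k, N k (c : ℂ) Q = 0 →
      ρ ≤ dist ((σ x, σ r) : ℂ × ℂ) Q) :
    ∑ v : InfinitePlace K, (v.mult : ℝ) * log⁺ (v (N k (c : K) (x, r)))⁻¹ ≤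
      Module.finrank ℚ K * log⁺ δ⁻¹ := by
  have hterm : ∀ v : InfinitePlace K,
      (v.mult : ℝ) * log⁺ (v (N k (c : K) (x, r)))⁻¹ ≤ (v.mult : ℝ) * log⁺ δ⁻¹ := fun v =>
    mul_le_mul_of_nonneg_left (posLog_infinitePlace_le hxr hδ h v (hsep v.embedding))
      (Nat.cast_nonneg _)
  calc ∑ v : InfinitePlace K, (v.mult : ℝ) * log⁺ (v (N k (c : K) (x, r)))⁻¹
      ≤ ∑ v : InfinitePlace K, (v.mult : ℝ) * log⁺ δ⁻¹ := Finset.sum_le_sum fun v _ => hterm v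
    _ = (∑ v : InfinitePlace K, (v.mult : ℝ)) * log⁺ δ⁻¹ := by rw [Finset.sum_mul]
    _ = Module.finrank ℚ K * log⁺ δ⁻¹ := by
      rw [← Nat.cast_sum, InfinitePlace.sum_mult_eq]

/-- THE FINITE PART OF THE HEIGHT OF `N_c(P)` IS LARGE (GENELLTWO-P1ROUTE §3 (d), family version):
for a number field `K`, `c ∈ ℚ`, and `(x, r) ∈ D_e(K)` all of whose complex conjugates are
`ρ`-separated from the zeros of `N_c` on `D_e(ℂ)`,
`logHeight₁ (N_c(x,r)) − [K:ℚ]·log⁺ δ⁻¹ ≤ Σᶠ_{w finite} log⁺ (w N_c(x,r))⁻¹`.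
[cite: MochizukiGenEll2010, Thm 2.1 p.12] -/
theorem logHeight₁_sub_le_finsum_posLog {K : Type*} [Field K] [NumberField K] {x r : K} {c : ℚ}
    (hxr : r ^ (2 * k + 1) = x * (1 - x)) {ρ δ : ℝ} (hδ : 0 < δ)
    (h : ∀ P ∈ DeArch.curve ℂ k, (∀ Q ∈ DeArch.curve ℂ k, N k (c : ℂ) Q = 0 → ρ ≤ dist P Q) →
      δ ≤ ‖N k (c : ℂ) P‖)
    (hsep : ∀ σ : K →+* ℂ, ∀ Q ∈ DeArch.curve ℂ k, N k (c : ℂ) Q = 0 →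
      ρ ≤ dist ((σ x, σ r) : ℂ × ℂ) Q) :
    logHeight₁ (N k (c : K) (x, r)) - Module.finrank ℚ K * log⁺ δ⁻¹ ≤
      ∑ᶠ w : FinitePlace K, log⁺ (w (N k (c : K) (x, r)))⁻¹ := by
  have hdec := NumberField.logHeight₁_eq (N k (c : K) (x, r))⁻¹
  rw [Height.logHeight₁_inv] at hdec
  have harch : ∑ v : InfinitePlace K, (v.mult : ℝ) * log⁺ (v (N k (c : K) (x, r))⁻¹) ≤
      Module.finrank ℚ K * log⁺ δ⁻¹ := by
    simp_rw [map_inv₀]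
    exact sum_mult_posLog_infinitePlace_le hxr hδ h hsep
  have hfin : ∑ᶠ w : FinitePlace K, log⁺ (w (N k (c : K) (x, r))⁻¹) =
      ∑ᶠ w : FinitePlace K, log⁺ (w (N k (c : K) (x, r)))⁻¹ := by
    simp_rw [map_inv₀]
  rw [← hfin]
  linarith

/-- Packaged form of `logHeight₁_sub_le_finsum_posLog`: `∀ c ∈ ℚ^×, ∀ ρ > 0 ∃ C ≥ 0` (depending only
on `e`, `c`, `ρ`) such that for every number field `K` and `(x, r) ∈ D_e(K)` with `ρ`-separated
conjugates, `logHeight₁ (N_c(x,r)) ≤ Σᶠ_{w finite} log⁺ (w N_c(x,r))⁻¹ + [K:ℚ]·C`.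
[cite: MochizukiGenEll2010, Thm 2.1 p.12] -/
theorem exists_logHeight₁_le_finsum_posLog_add (k : ℕ) {c : ℚ} (hc : c ≠ 0) {ρ : ℝ}
    (hρ : 0 < ρ) :
    ∃ C : ℝ, 0 ≤ C ∧ ∀ (K : Type) [Field K] [NumberField K] (x r : K),
      r ^ (2 * k + 1) = x * (1 - x) →
      (∀ σ : K →+* ℂ, ∀ Q ∈ DeArch.curve ℂ k, N k (c : ℂ) Q = 0 →
        ρ ≤ dist ((σ x, σ r) : ℂ × ℂ) Q) →
      logHeight₁ (N k (c : K) (x, r)) ≤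
        (∑ᶠ w : FinitePlace K, log⁺ (w (N k (c : K) (x, r)))⁻¹) + Module.finrank ℚ K * C := by
  obtain ⟨δ, hδ, h⟩ :=
    exists_pos_le_norm_N_of_separated k (c := (c : ℂ)) (by exact_mod_cast hc) hρ
  refine ⟨log⁺ δ⁻¹, posLog_nonneg, fun K _ _ x r hxr hsep => ?_⟩
  have := logHeight₁_sub_le_finsum_posLog hxr hδ h hsep
  linarith

end HeightForm

end DeFamily

end Literature.NumberTheory.DiophantineGeometry.GenEll
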